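import Literature.Probability.Percolation.ZdNearCriticalWindowProofs
import HarnessLib

/-!
# Kesten's relation for bond percolation on `ℤ²` (`Kesten1987_zdKestenRelation`): its two remaining
# near-critical inputs as named facts — the pivotal count at the running parameter and the
# stability of the four-arm probability below `L_ε`

Topic `Literature/Probability/Percolation`. Librarian fact decomposition (`fact-decompose`, human
2026-08-16) of the budget-capped named fact
`Literature.Probability.Percolation.Kesten1987_zdKestenRelation` (`ZdNearCriticalWindow.lean`;
Kesten 1987, (4.5); Nolin 2008, Prop. 34 [arXiv 0711.4948: Prop. 32]:
`|p − 1/2| · L_ε(p)² · α₄(1, L_ε(p)) ≍ 1` for BOND percolation on `ℤ²`).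

State of the tree: `ZdNearCriticalWindowProofs.lean` PROVES the Russo–integration layer of the
printed proof (`Kesten1987_zdKestenRelation_of_pivotalCount`: Russo's formula for the square
crossing, sub-critical decay, `L_ε → ∞`, the mean value inequality, the symmetry `p ↔ 1 − p`)
from ONE displayed hypothesis `hPC`, the two-sided pivotal count
`Σ_e P_t(e pivotal for LR([0,N]²)) ≍ N² α₄(1, N)` for `t ∈ (1/2 − δ, 1/2)`, `n₁ ≤ N ≤ L_ε(t)`, with
the CRITICAL four-arm probability `α₄(1, N) = zdCritFourArmProb 1 N` on the right. In print this
estimate is the product of two separately stated near-critical theorems (Werner 2009, Lecture 6: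
Lemma 6.2 — pivotal count `≍ n² π̂_p(n)` at the SAME parameter `p` — and Lemma 6.3 — `π̂_p(n) ≍
π̂_{1/2}(n)` below `L(p)`; Nolin 2008, proof of Prop. 32 and Thm. 27; originally Kesten 1987), whose
site-`𝕋` renderings are the tree's named facts `Werner2009_lemma62P` and `Werner2009_lemma63`
(`WernerPivotalEstimates.lean`). This file records their bond-`ℤ²` counterparts and the PROVED
assembly:

* `Kesten1987_zdPivotalCount_sameParam` — (A) for `ε ∈ (0, 1/2)`: `∃ n₁ δ c C`, for
  `t ∈ (1/2 − δ, 1/2)` and `n₁ ≤ N ≤ L_ε(t)`,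
  `c N² α₄,t(1, N) ≤ Σ_{e ⊆ [0,N]²} P_t(e pivotal for LR([0,N]²)) ≤ C N² α₄,t(1, N)`
  (`α₄,t = zdFourArmProbAt t`);
* `Kesten1987_zdFourArmStability` — (B) same range: `c α₄,_{1/2}(1, N) ≤ α₄,t(1, N) ≤ C α₄,_{1/2}(1, N)`;
* `Kesten1987_zdKestenRelation_holds_of : (A) → (B) → Kesten1987_zdKestenRelation` — multiply the
  constants (`zdPivotalCount_of_sameParam_of_stability`) and apply
  `Kesten1987_zdKestenRelation_of_pivotalCount`.

Neither child restates the parent (a derivative/pivotal estimate and a ratio bound on arm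
probabilities vs. the relation between `|p − 1/2|`, `L_ε(p)` and `α₄`). Only parameters
`t < 1/2` are quantified, which is all the integration uses (the case `p > 1/2` of the parent is
the case `1 − p`, `zdCharLength_symm`).

## References

* H. Kesten, Scaling relations for 2D-percolation, *Comm. Math. Phys.* 109 (1987) 109–156, §1,
  (4.5), Lemma 8 (site and bond percolation on `ℤ²`; not held — locators as quoted by Nolin 2008,
  §8.1 and van den Berg–Nolin) [KestenScalingCMP1987].
* P. Nolin, Near-critical percolation in two dimensions, *Electron. J. Probab.* 13 (2008), Thm. 27,
  §7.3 Prop. 34 and its proof, Remark 35; §8.1 (bond percolation on the square lattice)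
  [arXiv 0711.4948: Thm. 26, Prop. 32, Remark 34] [Nolin2008].
* W. Werner, *Lectures on two-dimensional critical percolation*, PCMI 16 (2009), Lecture 6,
  Lemma 6.2, Lemma 6.3 [WernerPCMI2009].
-/

noncomputable section

open MeasureTheory Set Filter Topology
open scoped unitInterval

namespace Literature.Probability.Percolation

open LatticeModels

/-! ### The two children -/

/-- **(A) The pivotal count of the square crossing at the running parameter**, bond percolation on
`ℤ²` (Werner 2009, Lecture 6, Lemma 6.2: "Uniformly for `n ≤ L(p)`, `d/dp h_p(n) ≍ n² π̂_p(n)`",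
with "`d/dp h_p(n) = Σ_x P_p(x is pivotal)`"; Nolin 2008, §7.3, proof of Prop. 34 [arXiv:
Prop. 32], last display: the sites of `[ηL, (1−η)L]²` "each produce a contribution of the same
order" `P̂(0 ⇝⁴ ∂S_{L})`, boundary sites less — by arm separation Thm. 11 and the half-plane
3-arm exponent; Kesten 1987 for both site and bond percolation on `ℤ²`, cf. Nolin §8.1). Rendered,
at most weaker than printed (sub-critical side only, inner radius `1`): for every `ε ∈ (0, 1/2)`
there are `n₁`, `δ > 0`, `c > 0`, `C` such that for `t ∈ (1/2 − δ, 1/2)` and `n₁ ≤ N ≤ L_ε(t)`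
(`zdCharLength`), `c·N²·α₄,t(1,N) ≤ Σ_{e ⊆ [0,N]²} P_t(e ∈ E(ℤ²) pivotal for LR([0,N]²)) ≤
C·N²·α₄,t(1,N)`, where `α₄,t(1,N) = zdFourArmProbAt t 1 N` is the four-arm probability AT
PARAMETER `t` (cluster form `fourArmTwoClusters`) and the pivotal sum is that of Russo's formula
`hasDerivAt_crossingProb_sq`. Bond-`ℤ²` twin of `Werner2009_lemma62P`; the upper bound for the
central edges is the tree's `sum_real_isPivotal_central_le` (`ZdPivotalFourArmSum.lean`).
[cite: WernerPCMI2009, Lecture 6, Lemma 6.2] [cite: Nolin2008, §7.3, proof of Prop. 34, last display, and Remark 35 (arXiv 0711.4948: Prop. 32, Remark 34); §8.1] [cite: KestenScalingCMP1987, (4.5) and its proof] -/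
def Kesten1987_zdPivotalCount_sameParam : Prop :=
  ∀ ⦃ε : ℝ⦄, 0 < ε → ε < 1 / 2 →
    ∃ n₁ : ℕ, ∃ δ > (0 : ℝ), ∃ c > (0 : ℝ), ∃ C : ℝ,
      ∀ t : unitInterval, 1 / 2 - δ < (t : ℝ) → (t : ℝ) < 1 / 2 →
        ∀ N : ℕ, n₁ ≤ N → N ≤ zdCharLength ε t →
          c * ((N : ℝ) ^ 2 * zdFourArmProbAt t 1 N) ≤
              ∑ e ∈ (rectangle N N).sym2, (bondPercolation (zdGraph 2) t).real
                {ω | e ∈ (zdGraph 2).edgeSet ∧ IsPivotal (lrCrossing N N) e ω} ∧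
            ∑ e ∈ (rectangle N N).sym2, (bondPercolation (zdGraph 2) t).real
                {ω | e ∈ (zdGraph 2).edgeSet ∧ IsPivotal (lrCrossing N N) e ω} ≤
              C * ((N : ℝ) ^ 2 * zdFourArmProbAt t 1 N)

/-- **(B) Near-critical stability of the four-arm probability below the characteristic length**,
bond percolation on `ℤ²` (Kesten 1987, Lemma 8 / Thm. 1; Nolin 2008, Thm. 27 [arXiv: Thm. 26]:
"Let `ε ∈ (0, 1/2)`, `j ≥ 1`, `σ` a colour sequence; then `P̂(A_{j,σ}(n, N)) ≍ P_{1/2}(A_{j,σ}(n, N))`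
uniformly in `p`, `P̂` between `P_p` and `P_{1−p}` and `n ≤ N ≤ L_ε(p)`", case `j = 4`,
alternating `σ`; Werner 2009, Lecture 6, Lemma 6.3: "`π̂_{p'}(L(p₀)) ≍ π̂_{1/2}(L(p₀))`", and §2,
p. 44; Nolin §8.1 for the square lattice / bond case). Rendered, at most weaker than printed
(sub-critical side, inner radius `1`): for every `ε ∈ (0, 1/2)` there are `n₁`, `δ > 0`, `c > 0`,
`C` such that for `t ∈ (1/2 − δ, 1/2)` and `n₁ ≤ N ≤ L_ε(t)`,
`c·α₄,_{1/2}(1,N) ≤ α₄,t(1,N) ≤ C·α₄,_{1/2}(1,N)` (`zdFourArmProbAt t 1 N` vs.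
`zdCritFourArmProb 1 N`). Bond-`ℤ²` twin of `Werner2009_lemma63`.
[cite: Nolin2008, Thm. 27 (j = 4; arXiv 0711.4948: Thm. 26); §8.1] [cite: WernerPCMI2009, Lecture 6, Lemma 6.3 and §2 (p. 44)] [cite: KestenScalingCMP1987, Lemma 8] -/
def Kesten1987_zdFourArmStability : Prop :=
  ∀ ⦃ε : ℝ⦄, 0 < ε → ε < 1 / 2 →
    ∃ n₁ : ℕ, ∃ δ > (0 : ℝ), ∃ c > (0 : ℝ), ∃ C : ℝ,
      ∀ t : unitInterval, 1 / 2 - δ < (t : ℝ) → (t : ℝ) < 1 / 2 →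
        ∀ N : ℕ, n₁ ≤ N → N ≤ zdCharLength ε t →
          c * zdCritFourArmProb 1 N ≤ zdFourArmProbAt t 1 N ∧
            zdFourArmProbAt t 1 N ≤ C * zdCritFourArmProb 1 N

/-! ### The assembly -/

/-- **(A) ∧ (B) ⟹ the pivotal count against the critical four-arm probability** (the hypothesis
`hPC` of `Kesten1987_zdKestenRelation_of_pivotalCount`): multiply the constants — Werner 2009,
Lecture 6, "Lemma 6.2 combined with Lemma 6.3" (the step behind the tree's composite
`Werner2009_lemma62W`, here for bond percolation on `ℤ²`). [cite: WernerPCMI2009, Lecture 6, Lemma 6.2 and Lemma 6.3] -/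
theorem zdPivotalCount_of_sameParam_of_stability (hA : Kesten1987_zdPivotalCount_sameParam)
    (hB : Kesten1987_zdFourArmStability) :
    ∀ ⦃ε : ℝ⦄, 0 < ε → ε < 1 / 2 →
      ∃ n₁ : ℕ, ∃ δ > (0 : ℝ), ∃ c > (0 : ℝ), ∃ C : ℝ,
        ∀ t : unitInterval, 1 / 2 - δ < (t : ℝ) → (t : ℝ) < 1 / 2 →
          ∀ N : ℕ, n₁ ≤ N → N ≤ zdCharLength ε t →
            c * ((N : ℝ) ^ 2 * zdCritFourArmProb 1 N) ≤
                ∑ e ∈ (rectangle N N).sym2, (bondPercolation (zdGraph 2) t).real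
                  {ω | e ∈ (zdGraph 2).edgeSet ∧ IsPivotal (lrCrossing N N) e ω} ∧
              ∑ e ∈ (rectangle N N).sym2, (bondPercolation (zdGraph 2) t).real
                  {ω | e ∈ (zdGraph 2).edgeSet ∧ IsPivotal (lrCrossing N N) e ω} ≤
                C * ((N : ℝ) ^ 2 * zdCritFourArmProb 1 N) := by
  intro ε hε hε'
  obtain ⟨n₁, δ₁, hδ₁, c₁, hc₁, C₁, h₁⟩ := hA hε hε'
  obtain ⟨n₂, δ₂, hδ₂, c₂, hc₂, C₂, h₂⟩ := hB hε hε'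
  refine ⟨max n₁ n₂, min δ₁ δ₂, lt_min hδ₁ hδ₂, c₁ * c₂, mul_pos hc₁ hc₂,
    max C₁ 0 * max C₂ 0, fun t ht₁ ht₂ N hN hNL => ?_⟩
  have hδ : min δ₁ δ₂ ≤ δ₁ := min_le_left _ _
  have hδ' : min δ₁ δ₂ ≤ δ₂ := min_le_right _ _
  obtain ⟨hlo₁, hup₁⟩ := h₁ t (by linarith) ht₂ N (le_trans (le_max_left _ _) hN) hNL
  obtain ⟨hlo₂, hup₂⟩ := h₂ t (by linarith) ht₂ N (le_trans (le_max_right _ _) hN) hNL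
  set S : ℝ := ∑ e ∈ (rectangle N N).sym2, (bondPercolation (zdGraph 2) t).real
      {ω | e ∈ (zdGraph 2).edgeSet ∧ IsPivotal (lrCrossing N N) e ω} with hS
  have hN2 : 0 ≤ (N : ℝ) ^ 2 := sq_nonneg _
  have hαt : 0 ≤ zdFourArmProbAt t 1 N := zdFourArmProbAt_nonneg _ _ _
  have hαc : 0 ≤ zdCritFourArmProb 1 N := zdFourArmProbAt_nonneg _ _ _
  constructor
  · -- lower: `c₁ c₂ N² α_c ≤ c₁ N² α_t ≤ S`
    calc c₁ * c₂ * ((N : ℝ) ^ 2 * zdCritFourArmProb 1 N)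
        = c₁ * ((N : ℝ) ^ 2 * (c₂ * zdCritFourArmProb 1 N)) := by ring
      _ ≤ c₁ * ((N : ℝ) ^ 2 * zdFourArmProbAt t 1 N) := by
          gcongr
      _ ≤ S := hlo₁
  · -- upper: `S ≤ C₁ N² α_t ≤ max C₁ 0 · N² · max C₂ 0 · α_c`
    have hup₂' : zdFourArmProbAt t 1 N ≤ max C₂ 0 * zdCritFourArmProb 1 N :=
      hup₂.trans (mul_le_mul_of_nonneg_right (le_max_left _ _) hαc)
    calc S ≤ C₁ * ((N : ℝ) ^ 2 * zdFourArmProbAt t 1 N) := hup₁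
      _ ≤ max C₁ 0 * ((N : ℝ) ^ 2 * zdFourArmProbAt t 1 N) :=
          mul_le_mul_of_nonneg_right (le_max_left _ _) (mul_nonneg hN2 hαt)
      _ ≤ max C₁ 0 * ((N : ℝ) ^ 2 * (max C₂ 0 * zdCritFourArmProb 1 N)) := by
          gcongr
      _ = max C₁ 0 * max C₂ 0 * ((N : ℝ) ^ 2 * zdCritFourArmProb 1 N) := by ring

/-- **Kesten's scaling relation for the characteristic length of bond percolation on `ℤ²`
(`Kesten1987_zdKestenRelation`) from (A) the pivotal count at the running parameter and (B) the
four-arm stability below `L_ε`** — the fact split: `Kesten1987_zdKestenRelation_of_pivotalCount`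
(Russo's formula and the integration between `p` and `1/2`, proved) applied to
`zdPivotalCount_of_sameParam_of_stability`. [cite: KestenScalingCMP1987, (4.5)] [cite: Nolin2008, §7.3, Prop. 34 and its proof (arXiv 0711.4948: Prop. 32)] [cite: WernerPCMI2009, Lecture 6, Lemma 6.2, Cor. 6.3, Lemma 6.3] -/
theorem Kesten1987_zdKestenRelation_holds_of (hA : Kesten1987_zdPivotalCount_sameParam)
    (hB : Kesten1987_zdFourArmStability) : Kesten1987_zdKestenRelation :=
  Kesten1987_zdKestenRelation_of_pivotalCount (zdPivotalCount_of_sameParam_of_stability hA hB)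

end Literature.Probability.Percolation

end
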